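import Summits.BirchSwinnertonDyer.BirchSwinnertonDyer.Theorems.ByReductionTypeAtTwoMultUpperHalfKatoIntSplit
import Summits.BirchSwinnertonDyer.BirchSwinnertonDyer.Theses.ByReductionTypeAtTwo
import HarnessLib

/-!
# `MultUpperHalfAtTwo` (item stmt-BirchSwinnertonDyer-19922) — the ITEM-CLOSING LEAF of the multiplicative
# upper-half chain (import refactor H3, director-bsd 2026-08-26)

Standing build rule (21-frontier 2026-08-26): only an item closer / leaf load-bearing file may import a
`…Theses.<Route>` file. The three chain modules
`Theorems/ByReductionTypeAtTwoMultUpperHalf.lean` (two roads + optimal-514 corollary, p418902),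
`…MultUpperHalfGuarded.lean` (four roads, `hEC`-abstract, p43xxxx) and `…MultUpperHalfKatoIntSplit.lean`
(six roads) are imported by ≈ 1 100 certificate modules (579 under `Rank1Residual/X5/`); they used to import the
route file for the sole purpose of stating their final reductions with conclusion
`Summit.BirchSwinnertonDyer.BirchSwinnertonDyer.Theses.ByReductionTypeAtTwo.MultUpperHalfAtTwo`.
Those six reductions are moved here VERBATIM (same names, same namespace, same proofs, same order):

* `multUpperHalfAtTwo_of_optimalMuZero_of_offRoad` (from `…MultUpperHalf.lean`);
* `multUpperHalfAtTwo_of_fourRoads_of_eulerChar`, `multUpperHalfAtTwo_of_fourRoads'`,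
  `multUpperHalfAtTwo_of_leaves_fourRoads'` (from `…MultUpperHalfGuarded.lean`);
* `multUpperHalfAtTwo_of_sixRoads_of_eulerChar`, `multUpperHalfAtTwo_of_sixRoads'` (from `…MultUpperHalfKatoIntSplit.lean`).

Nothing mathematical changes; users of these names (`…MultUpperHalfGlue.lean`) import this leaf.
-/

set_option autoImplicit false
set_option linter.dupNamespace false

noncomputable section

open scoped Classical MatrixGroups ModularForm

open CongruenceSubgroup WeierstrassCurve Literature.NumberTheory.EllipticCurves
  Literature.NumberTheory.EllipticCurves.ModularForms
  Literature.NumberTheory.EllipticCurves.Greenberg1999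
  Literature.NumberTheory.EllipticCurves.Rank1Residual
  Literature.NumberTheory.EllipticCurves.Rank1Residual.Typed
  Literature.NumberTheory.Transcendental
  Summit.BirchSwinnertonDyer.Rank1Residual.X5

namespace Summit.BirchSwinnertonDyer.BirchSwinnertonDyer.Theorems

/-- **Item stmt-BirchSwinnertonDyer-19922 `MultUpperHalfAtTwo` as «optimal-μ-zero sub-block + residual»
(conditional; FULLY-QUALIFIED type).** PRINT {A235 `h41ns`, A236 `h41sp`, modularity `hmod`, GZK `hGZK`, Cassels `hCassels`, Greenberg Prop. 5.14 at `2` `h514`, Česnavičius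
Thm. 1.2 `hC`} + MEMO {Kato `⊗ℚ` at a multiplicative `2` `hKato` (PROOF-MULT, RC-2), Greenberg–Stevens at a
split `2` `hGS` (PROOF-GS2, RC-4)} + ONE residual hypothesis `hoff` — the upper half AT THE
`X₀(N)`-OPTIMAL CURVES `W₀` (globally minimal, non-CM, analytic rank `0`, multiplicative at `2`, carrying
a lattice-optimal parametrisation datum at level `N_{W₀}`) whose cyclotomic `μ`-invariant is NOT known
to vanish (neither `μ(X(W₀/ℚ_∞)) = 0` for all cyclotomic dual data nor a Prop-5.14 datum) — imply
`MultUpperHalfAtTwo`. Proof: every class has an optimal member (`X12.exists_isIsogenous_optimal`, from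
modularity); on it the period input is PRINT (§2), so §4 applies when `μ = 0` there, and `hoff` covers
the rest; Cassels moves the half to every member. The residual is expected NON-EMPTY (optimal curves with
`μ ≥ 1`, cf. Greenberg's conductor-`15` table at `2`; there the `μ`-part of Kato's divisibility at `2` is
needed, and Kato 17.4 (3) prints `p ≠ 2`), so this is a partition certificate, not a proof of the item.
[cite: Kato2004Asterisque, Thm. 17.4 (p. 273)] [cite: GreenbergLNM1716, Prop. 5.13, Prop. 5.14 and §4 pp. 112–113]
[cite: Cesnavicius2018, Thm. 1.2] [cite: Cassels1965ArithmeticVIII] [cite: Miller2011LMS, Def. 1.1] -/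
theorem multUpperHalfAtTwo_of_optimalMuZero_of_offRoad
    (hKato : ∀ (W : WeierstrassCurve ℚ) [W.IsElliptic] [W.IsGloballyMinimal],
      ¬ W.HasCM → Mult W 2 → O1.KatoMultiplicativeDivisibilityRat W 2)
    (h41ns : thm41Analogue_charValue_rankZero_numberField_anyPrime)
    (h41sp : thm41Analogue_charValue_rankZero_split_baseChange_anyPrime)
    (hmod : nonempty_modularParametrizationData)
    (hGZK : rank_eq_analyticRank_of_analyticRank_le_one)
    (hCassels : bsdRHS_eq_of_isIsogenous)
    (h514 : prop514_isTorsion_mu_eq_zero_two)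
    (hC : cesnavicius_not_two_dvd_maninConstant_of_two_dvd_level)
    (hGS : ∀ (W : WeierstrassCurve ℚ) [W.IsElliptic] [W.IsGloballyMinimal],
      W.HasSplitMultiplicativeReductionAtPrime 2 → greenberg_stevens (W := W) (p := 2))
    (hoff : ∀ (W₀ : WeierstrassCurve ℚ) [W₀.IsElliptic] [W₀.IsGloballyMinimal]
      [NeZero (W₀.conductorNorm ℤ)], ¬ W₀.HasCM → W₀.analyticRank = 0 → Mult W₀ 2 →
      ∀ D₀ : ModularParametrizationData W₀ (W₀.conductorNorm ℤ), Zhai2021.IsOptimalDatum W₀ D₀ →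
      (¬ ∀ (κ : ZpExtension ℚ 2) (γ : Field.absoluteGaloisGroup ℚ), κ.IsCyclotomic →
          κ.IsTopGenerator γ → IsCyclotomicVariable 2 γ → ∀ D : W₀.SelmerDualData κ γ, D.mu = 0) →
      (¬ ∃ x y : ℚ, W₀.toAffine.Equation x y ∧ 2 * y + W₀.a₁ * x + W₀.a₃ = 0 ∧
          ((TwoTorsionRamifiedAtTwo x ∧ ¬ TwoTorsionOdd W₀ x) ∨
            (TwoTorsionOdd W₀ x ∧ ¬ TwoTorsionRamifiedAtTwo x))) →
      MissingUpperBoundAt W₀ 2) :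
    Summit.BirchSwinnertonDyer.BirchSwinnertonDyer.Theses.ByReductionTypeAtTwo.MultUpperHalfAtTwo := by
  unfold Summit.BirchSwinnertonDyer.BirchSwinnertonDyer.Theses.ByReductionTypeAtTwo.MultUpperHalfAtTwo
  intro W _ _ _ hr hmult
  have hnf : exists_isNewformOf := exists_isNewformOf_of_nonempty_modularParametrizationData hmod
  -- the optimal member of the class
  obtain ⟨W₀, hE₀, hM₀, hN₀, D₀, hiso, -, hopt⟩ :=
    Summit.BirchSwinnertonDyer.Rank1Residual.X12.exists_isIsogenous_optimal hnf W
  by_cases hμ₀ : ∀ (κ : ZpExtension ℚ 2) (γ : Field.absoluteGaloisGroup ℚ), κ.IsCyclotomic →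
      κ.IsTopGenerator γ → IsCyclotomicVariable 2 γ → ∀ D : W₀.SelmerDualData κ γ, D.mu = 0
  · exact missingUpperBoundAt_two_mult_of_roadMember hKato h41ns h41sp hmod hGZK hCassels h514 hC hGS
      W hr hmult W₀ hiso (Or.inl hμ₀) (Or.inr (Or.inl fun {_} ↦ ⟨D₀, hopt⟩))
  by_cases h514₀ : ∃ x y : ℚ, W₀.toAffine.Equation x y ∧ 2 * y + W₀.a₁ * x + W₀.a₃ = 0 ∧
      ((TwoTorsionRamifiedAtTwo x ∧ ¬ TwoTorsionOdd W₀ x) ∨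
        (TwoTorsionOdd W₀ x ∧ ¬ TwoTorsionRamifiedAtTwo x))
  · exact missingUpperBoundAt_two_mult_of_roadMember hKato h41ns h41sp hmod hGZK hCassels h514 hC hGS
      W hr hmult W₀ hiso (Or.inr h514₀) (Or.inr (Or.inl fun {_} ↦ ⟨D₀, hopt⟩))
  -- off the road: the residual hypothesis at `W₀`, then Cassels
  have hmult₀ : Mult W₀ 2 :=
    Summit.BirchSwinnertonDyer.Rank1Residual.X2.IsogenyQuotientLine.hasMultiplicativeReductionAtPrime_of_isIsogenous
      hiso hmult
  have hr₀ : W₀.analyticRank = 0 := (analyticRank_eq_of_isIsogenous' hiso).symm.trans hr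
  have hcm₀ : ¬ W₀.HasCM := fun h ↦ Rank1Residual.not_mult_of_hasCM W₀ h 2 hmult₀
  have hU₀ : MissingUpperBoundAt W₀ 2 := hoff W₀ hcm₀ hr₀ hmult₀ D₀ hopt hμ₀ h514₀
  obtain ⟨Dm⟩ := hmod W₀
  have hlead₀ : W₀.leadingLCoeff ≠ 0 :=
    W₀.leadingLCoeff_ne_zero_holds Dm.isNewformOf.hasEntireLFunction
  have hfin₀ : Finite W₀.sha := (hGZK W₀ (by rw [hr₀]; exact zero_le_one)).2
  exact Summit.BirchSwinnertonDyer.Rank1Residual.X12.missingUpperBoundAt_of_isIsogenous hCassels hiso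
    hfin₀ hlead₀ hU₀

/-- **Item 19922 `MultUpperHalfAtTwo` ⟸ four roads + residual, with the non-split control display for every
curve as the binder `hECns`** (FULLY-QUALIFIED type; twin of `multUpperHalfAtTwo_of_fourRoads`, p429114, with
A235 replaced by the display it serves). PRINT ×7 {A236 `h41sp`, `hmod`, `hGZK`, `hCassels`, `h514`, `hC`,
`hCT`} + `hECns` + MEMO ×4 {`hKato`, `hGS`, `hKint`, `hK1`} + `hoff` (= `UpperHalfOffFourRoadsAtMultTwo` verbatim)
⟹ `MultUpperHalfAtTwo`: optimal member (`X12.exists_isIsogenous_optimal`), §1 at the optimal curve with the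
period datum PRINT there (`padicValRat_periodRatio_eq_zero_of_isOptimalDatum`), Cassels transport; else `hoff`.
A partition certificate, not a proof of the item. [cite: Kato2004Asterisque, Thm. 17.4 (p. 273) and 17.11–17.13]
[cite: GreenbergLNM1716, Prop. 5.13, Prop. 5.14 (pp. 120–122) and §4 pp. 112–113] [cite: Cesnavicius2018, Thm. 1.2]
[cite: Cassels1965ArithmeticVIII] [cite: Miller2011LMS, Def. 1.1] -/
theorem multUpperHalfAtTwo_of_fourRoads_of_eulerChar
    (hKato : ∀ (W : WeierstrassCurve ℚ) [W.IsElliptic] [W.IsGloballyMinimal],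
      ¬ W.HasCM → Mult W 2 → O1.KatoMultiplicativeDivisibilityRat W 2)
    (hECns : ∀ (W : WeierstrassCurve ℚ) [W.IsElliptic] [W.IsGloballyMinimal],
      O1.TwoAdicEulerCharRankZeroNonsplitMult W 0)
    (h41sp : thm41Analogue_charValue_rankZero_split_baseChange_anyPrime)
    (hmod : nonempty_modularParametrizationData)
    (hGZK : rank_eq_analyticRank_of_analyticRank_le_one)
    (hCassels : bsdRHS_eq_of_isIsogenous)
    (h514 : prop514_isTorsion_mu_eq_zero_two)
    (hC : cesnavicius_not_two_dvd_maninConstant_of_two_dvd_level)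
    (hCT : WeierstrassCurve.exists_casselsTate_pairing (K := ℚ))
    (hGS : ∀ (W : WeierstrassCurve ℚ) [W.IsElliptic] [W.IsGloballyMinimal],
      W.HasSplitMultiplicativeReductionAtPrime 2 → greenberg_stevens (W := W) (p := 2))
    (hKint : ∀ (W : WeierstrassCurve ℚ) [W.IsElliptic] [W.IsGloballyMinimal],
      O1.KatoDivisibilityAtTwoNonsplitMultInt W)
    (hK1 : ∀ (W : WeierstrassCurve ℚ) [W.IsElliptic] [W.IsGloballyMinimal] {N : ℕ} [NeZero N]
      (f : CuspForm (Gamma0 N) 2) (L : PowerSeries ℚ_[2]), O1.KatoDivisibilityAtTwoMultUpTo W 1 f (-1) L)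
    (hoff : ∀ (W₀ : WeierstrassCurve ℚ) [W₀.IsElliptic] [W₀.IsGloballyMinimal]
      [NeZero (W₀.conductorNorm ℤ)], ¬ W₀.HasCM → W₀.analyticRank = 0 → Mult W₀ 2 →
      ∀ D₀ : ModularParametrizationData W₀ (W₀.conductorNorm ℤ), Zhai2021.IsOptimalDatum W₀ D₀ →
      (¬ ∀ (κ : ZpExtension ℚ 2) (γ : Field.absoluteGaloisGroup ℚ), κ.IsCyclotomic →
          κ.IsTopGenerator γ → IsCyclotomicVariable 2 γ → ∀ D : W₀.SelmerDualData κ γ, D.mu = 0) →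
      (¬ ∃ x y : ℚ, W₀.toAffine.Equation x y ∧ 2 * y + W₀.a₁ * x + W₀.a₃ = 0 ∧
          ((TwoTorsionRamifiedAtTwo x ∧ ¬ TwoTorsionOdd W₀ x) ∨
            (TwoTorsionOdd W₀ x ∧ ¬ TwoTorsionRamifiedAtTwo x))) →
      ¬ (¬ W₀.HasSplitMultiplicativeReductionAtPrime 2 ∧ O1.TwoAdicSurjective W₀ ∧ W₀.Δ < 0) →
      ¬ (¬ W₀.HasSplitMultiplicativeReductionAtPrime 2 ∧ O1.TwoAdicSurjective W₀ ∧
          ∃ q : ℚ, shaAn W₀ = (q : ℂ) ∧ Even (padicValRat 2 q)) →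
      MissingUpperBoundAt W₀ 2) :
    Summit.BirchSwinnertonDyer.BirchSwinnertonDyer.Theses.ByReductionTypeAtTwo.MultUpperHalfAtTwo := by
  unfold Summit.BirchSwinnertonDyer.BirchSwinnertonDyer.Theses.ByReductionTypeAtTwo.MultUpperHalfAtTwo
  intro W _ _ _ hr hmult
  have hnf : exists_isNewformOf := exists_isNewformOf_of_nonempty_modularParametrizationData hmod
  obtain ⟨W₀, hE₀, hM₀, hN₀, D₀, hiso, -, hopt⟩ :=
    Summit.BirchSwinnertonDyer.Rank1Residual.X12.exists_isIsogenous_optimal hnf W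
  have hmult₀ : Mult W₀ 2 :=
    Summit.BirchSwinnertonDyer.Rank1Residual.X2.IsogenyQuotientLine.hasMultiplicativeReductionAtPrime_of_isIsogenous
      hiso hmult
  have hr₀ : W₀.analyticRank = 0 := (analyticRank_eq_of_isIsogenous' hiso).symm.trans hr
  have hcm₀ : ¬ W₀.HasCM := fun h ↦ Rank1Residual.not_mult_of_hasCM W₀ h 2 hmult₀
  -- the period datum at the optimal curve is PRINT
  have hper₀ : ∀ [NeZero (W₀.conductorNorm ℤ)] (f : CuspForm (Gamma0 (W₀.conductorNorm ℤ)) 2),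
      IsNewformOf W₀ f → ∀ ϖ : ℚ, (ϖ : ℝ) * W₀.realPeriodRat = plusPeriod f → 0 ≤ padicValRat 2 ϖ :=
    fun f hf ϖ hϖ ↦ (padicValRat_periodRatio_eq_zero_of_isOptimalDatum hC W₀ hmult₀ D₀ hopt f hf ϖ hϖ).ge
  refine missingUpperBoundAt_two_of_isogenous_member hmod hGZK hCassels W hr W₀ hiso ?_
  -- road (i): `μ = 0` at `W₀`
  by_cases hμ₀ : ∀ (κ : ZpExtension ℚ 2) (γ : Field.absoluteGaloisGroup ℚ), κ.IsCyclotomic →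
      κ.IsTopGenerator γ → IsCyclotomicVariable 2 γ → ∀ D : W₀.SelmerDualData κ γ, D.mu = 0
  · exact missingUpperBoundAt_two_mult_of_mu_eq_zero_of_eulerChar W₀ (hKato W₀ hcm₀ hmult₀) (hECns W₀) h41sp
      hmod hGZK (hGS W₀) hμ₀ hper₀ hr₀ hmult₀
  -- road (ii): a Prop-5.14 datum at `W₀` (then `μ = 0` is PRINT)
  by_cases h514₀ : ∃ x y : ℚ, W₀.toAffine.Equation x y ∧ 2 * y + W₀.a₁ * x + W₀.a₃ = 0 ∧
      ((TwoTorsionRamifiedAtTwo x ∧ ¬ TwoTorsionOdd W₀ x) ∨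
        (TwoTorsionOdd W₀ x ∧ ¬ TwoTorsionRamifiedAtTwo x))
  · obtain ⟨x, y, hP, h2, hΦ⟩ := h514₀
    exact missingUpperBoundAt_two_mult_of_mu_eq_zero_of_eulerChar W₀ (hKato W₀ hcm₀ hmult₀) (hECns W₀) h41sp
      hmod hGZK (hGS W₀) (fun _ _ hκ hγ _ D ↦ (h514.of_mult W₀ hmult₀ hP h2 hΦ hκ hγ D).2) hper₀ hr₀ hmult₀
  -- road (iii): the sharp door
  by_cases hdoor : ¬ W₀.HasSplitMultiplicativeReductionAtPrime 2 ∧ O1.TwoAdicSurjective W₀ ∧ W₀.Δ < 0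
  · exact missingUpperBoundAt_two_nonsplit_of_katoInt_of_eulerChar W₀ (hECns W₀) hmod hGZK (hKint W₀) hper₀ hr₀
      hmult₀ hdoor.1 hdoor.2.1 hdoor.2.2
  -- road (iv): slack one + parity
  by_cases hpar : ¬ W₀.HasSplitMultiplicativeReductionAtPrime 2 ∧ O1.TwoAdicSurjective W₀ ∧
      ∃ q : ℚ, shaAn W₀ = (q : ℂ) ∧ Even (padicValRat 2 q)
  · exact missingUpperBoundAt_two_nonsplit_of_katoMultUpTo_one_of_even_of_eulerChar W₀ (hECns W₀) hmod hGZK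
      hCT hC (fun f L ↦ hK1 W₀ f L) hr₀ hmult₀ hpar.1 hpar.2.1 hpar.2.2
  -- off the roads
  exact hoff W₀ hcm₀ hr₀ hmult₀ D₀ hopt hμ₀ h514₀ hdoor hpar

/-! ## §3 The GUARDED-print instance (audit N-1) and its glue from leaves -/

/-- **The four-road reduction on the GUARDED twin of Greenberg's display** (`h41ns' :
thm41Analogue_charValue_rankZero_numberField_anyPrime_oddLocalDegree`, p425330; glue
`O1.twoAdicEulerCharRankZeroNonsplitMult_zero_of_greenberg'`, p428013): same conclusion as
`multUpperHalfAtTwo_of_fourRoads` (p429114) without the vacuity risk of A235 recorded by the cell's D-audit.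
[cite: GreenbergLNM1716, §3 Note (p. 93) and §4 pp. 112–113] [cite: Miller2011LMS, Def. 1.1] -/
theorem multUpperHalfAtTwo_of_fourRoads'
    (hKato : ∀ (W : WeierstrassCurve ℚ) [W.IsElliptic] [W.IsGloballyMinimal],
      ¬ W.HasCM → Mult W 2 → O1.KatoMultiplicativeDivisibilityRat W 2)
    (h41ns' : thm41Analogue_charValue_rankZero_numberField_anyPrime_oddLocalDegree)
    (h41sp : thm41Analogue_charValue_rankZero_split_baseChange_anyPrime)
    (hmod : nonempty_modularParametrizationData)
    (hGZK : rank_eq_analyticRank_of_analyticRank_le_one)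
    (hCassels : bsdRHS_eq_of_isIsogenous)
    (h514 : prop514_isTorsion_mu_eq_zero_two)
    (hC : cesnavicius_not_two_dvd_maninConstant_of_two_dvd_level)
    (hCT : WeierstrassCurve.exists_casselsTate_pairing (K := ℚ))
    (hGS : MultUpperHalvesAtTwo.GreenbergStevensAtSplitTwo) (hKint : MultUpperHalvesAtTwo.KatoIntAtNonsplitSurjectiveTwo)
    (hK1 : MultUpperHalvesAtTwo.KatoUpToOneAtNonsplitSurjectiveTwo)
    (hoff : MultUpperHalvesAtTwo.UpperHalfOffFourRoadsAtMultTwo) :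
    Summit.BirchSwinnertonDyer.BirchSwinnertonDyer.Theses.ByReductionTypeAtTwo.MultUpperHalfAtTwo :=
  multUpperHalfAtTwo_of_fourRoads_of_eulerChar hKato
    (fun W _ _ ↦ O1.twoAdicEulerCharRankZeroNonsplitMult_zero_of_greenberg' W h41ns') h41sp hmod hGZK hCassels
    h514 hC hCT hGS hKint hK1 hoff

/-- **GLUE (four roads, guarded PUB): item 19922 from its leaves** — PRINT ×8 with the GUARDED Thm-4.1
analogue `…_anyPrime_oddLocalDegree` in place of A235 → MEMO leaves {`GreenbergStevensAtSplitTwo`,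
`KatoRatAtMultTwo`, `KatoIntAtNonsplitSurjectiveTwo`, `KatoUpToOneAtNonsplitSurjectiveTwo`} → RESIDUAL leaf
`UpperHalfOffFourRoadsAtMultTwo` → `MultUpperHalfAtTwo`. [cite: GreenbergLNM1716, §4 pp. 112–113 and Prop. 5.14 (p. 121)]
[cite: Miller2011LMS, Def. 1.1] -/
theorem multUpperHalfAtTwo_of_leaves_fourRoads'
    (h41ns' : thm41Analogue_charValue_rankZero_numberField_anyPrime_oddLocalDegree)
    (h41sp : thm41Analogue_charValue_rankZero_split_baseChange_anyPrime)
    (hmod : nonempty_modularParametrizationData)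
    (hGZK : rank_eq_analyticRank_of_analyticRank_le_one)
    (hCassels : bsdRHS_eq_of_isIsogenous)
    (h514 : prop514_isTorsion_mu_eq_zero_two)
    (hC : cesnavicius_not_two_dvd_maninConstant_of_two_dvd_level)
    (hCT : WeierstrassCurve.exists_casselsTate_pairing (K := ℚ))
    (hGS : MultUpperHalvesAtTwo.GreenbergStevensAtSplitTwo) (hKato : MultUpperHalvesAtTwo.KatoRatAtMultTwo)
    (hKint : MultUpperHalvesAtTwo.KatoIntAtNonsplitSurjectiveTwo)
    (hK1 : MultUpperHalvesAtTwo.KatoUpToOneAtNonsplitSurjectiveTwo)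
    (hoff : MultUpperHalvesAtTwo.UpperHalfOffFourRoadsAtMultTwo) :
    Summit.BirchSwinnertonDyer.BirchSwinnertonDyer.Theses.ByReductionTypeAtTwo.MultUpperHalfAtTwo :=
  multUpperHalfAtTwo_of_fourRoads' hKato h41ns' h41sp hmod hGZK hCassels h514 hC hCT hGS hKint hK1 hoff

/-- **Item 19922 `MultUpperHalfAtTwo` ⟸ SIX roads + residual, non-split control display abstract** (FULLY-QUALIFIED
type; extends `multUpperHalfAtTwo_of_fourRoads_of_eulerChar`, p430028, by the two SPLIT roads). PRINT ×7 {A236 `h41sp`,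
`hmod`, `hGZK`, `hCassels`, `h514`, `hC`, `hCT`} + `hECns` (the non-split control display for every curve) + MEMO ×6
{`hKato` (Kato `⊗ℚ`, PROOF-MULT RC-2), `hGS` (PROOF-GS2 RC-4), `hKint` / `hK1` (T-KATO2-NSMULT sharp / slack one,
PROOF-KATO2MULT RC-32), `hKintSp` (T-KATO2-SPMULT sharp, `O1.KatoDivisibilityAtTwoSplitMultInt` for every curve) /
`hK1sp` (the same at slack one, spelled out; PROOF-KATO2SPLIT, RC requested)} + the residual `hoff`: the upper half
at every `X₀(N)`-optimal non-CM rank-`0` curve multiplicative at `2` OFF the six roads — (i) `μ = 0`, (ii) Prop 5.14,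
(iii) non-split ∧ surjective ∧ `Δ < 0`, (iv) non-split ∧ surjective ∧ `ord₂ #Ш_an` even, (v) split ∧ surjective ∧
`Δ < 0`, (vi) split ∧ surjective ∧ `ord₂ #Ш_an` even ⟹ `MultUpperHalfAtTwo`. Optimal member by
`X12.exists_isIsogenous_optimal`, period datum PRINT there, case split, Cassels transport; else `hoff`. A partition
certificate, not a proof of the item (census: 1 775 / 1 969 r0 classes on a road, residual 194 = 52 small image +
142 «neither»). [cite: Kato2004Asterisque, Thm. 17.4 (p. 273) and 17.11–17.13] [cite: GreenbergLNM1716, Prop. 5.13, Prop. 5.14 (pp. 120–122) and §4 pp. 112–113]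
[cite: Cesnavicius2018, Thm. 1.2] [cite: SilvermanAEC2009, Thm. X.4.14] [cite: Cassels1965ArithmeticVIII] [cite: Miller2011LMS, Def. 1.1] -/
theorem multUpperHalfAtTwo_of_sixRoads_of_eulerChar
    (hKato : ∀ (W : WeierstrassCurve ℚ) [W.IsElliptic] [W.IsGloballyMinimal],
      ¬ W.HasCM → Mult W 2 → O1.KatoMultiplicativeDivisibilityRat W 2)
    (hECns : ∀ (W : WeierstrassCurve ℚ) [W.IsElliptic] [W.IsGloballyMinimal],
      O1.TwoAdicEulerCharRankZeroNonsplitMult W 0)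
    (h41sp : thm41Analogue_charValue_rankZero_split_baseChange_anyPrime)
    (hmod : nonempty_modularParametrizationData)
    (hGZK : rank_eq_analyticRank_of_analyticRank_le_one)
    (hCassels : bsdRHS_eq_of_isIsogenous)
    (h514 : prop514_isTorsion_mu_eq_zero_two)
    (hC : cesnavicius_not_two_dvd_maninConstant_of_two_dvd_level)
    (hCT : WeierstrassCurve.exists_casselsTate_pairing (K := ℚ))
    (hGS : ∀ (W : WeierstrassCurve ℚ) [W.IsElliptic] [W.IsGloballyMinimal],
      W.HasSplitMultiplicativeReductionAtPrime 2 → greenberg_stevens (W := W) (p := 2))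
    (hKint : ∀ (W : WeierstrassCurve ℚ) [W.IsElliptic] [W.IsGloballyMinimal],
      O1.KatoDivisibilityAtTwoNonsplitMultInt W)
    (hK1 : ∀ (W : WeierstrassCurve ℚ) [W.IsElliptic] [W.IsGloballyMinimal] {N : ℕ} [NeZero N]
      (f : CuspForm (Gamma0 N) 2) (L : PowerSeries ℚ_[2]), O1.KatoDivisibilityAtTwoMultUpTo W 1 f (-1) L)
    (hKintSp : ∀ (W : WeierstrassCurve ℚ) [W.IsElliptic] [W.IsGloballyMinimal],
      O1.KatoDivisibilityAtTwoSplitMultInt W)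
    (hK1sp : ∀ (W : WeierstrassCurve ℚ) [W.IsElliptic] [W.IsGloballyMinimal],
      Mult W 2 → W.HasSplitMultiplicativeReductionAtPrime 2 → O1.TwoAdicSurjective W →
      ∀ (κ : ZpExtension ℚ 2) (γ : Field.absoluteGaloisGroup ℚ), κ.IsCyclotomic → κ.IsTopGenerator γ →
      IsCyclotomicVariable 2 γ →
      ∀ [NeZero (W.conductorNorm ℤ)] (f : CuspForm (Gamma0 (W.conductorNorm ℤ)) 2), IsNewformOf W f →
      ∀ ϖ : ℚ, (ϖ : ℝ) * W.realPeriodRat = plusPeriod f →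
      ∀ L : PowerSeries ℚ_[2], IsSplitMultPAdicLFunctionOf f 2 L → ∀ D : W.SelmerDualData κ γ,
        D.IsTorsion ∧ ∃ g ∈ D.charIdeal,
          iwasawaToPowerSeries 2 (PowerSeries.X * g) = PowerSeries.C ((2 * ϖ : ℚ) : ℚ_[2]) * L)
    (hoff : ∀ (W₀ : WeierstrassCurve ℚ) [W₀.IsElliptic] [W₀.IsGloballyMinimal]
      [NeZero (W₀.conductorNorm ℤ)], ¬ W₀.HasCM → W₀.analyticRank = 0 → Mult W₀ 2 →
      ∀ D₀ : ModularParametrizationData W₀ (W₀.conductorNorm ℤ), Zhai2021.IsOptimalDatum W₀ D₀ →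
      (¬ ∀ (κ : ZpExtension ℚ 2) (γ : Field.absoluteGaloisGroup ℚ), κ.IsCyclotomic →
          κ.IsTopGenerator γ → IsCyclotomicVariable 2 γ → ∀ D : W₀.SelmerDualData κ γ, D.mu = 0) →
      (¬ ∃ x y : ℚ, W₀.toAffine.Equation x y ∧ 2 * y + W₀.a₁ * x + W₀.a₃ = 0 ∧
          ((TwoTorsionRamifiedAtTwo x ∧ ¬ TwoTorsionOdd W₀ x) ∨
            (TwoTorsionOdd W₀ x ∧ ¬ TwoTorsionRamifiedAtTwo x))) →
      ¬ (¬ W₀.HasSplitMultiplicativeReductionAtPrime 2 ∧ O1.TwoAdicSurjective W₀ ∧ W₀.Δ < 0) →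
      ¬ (¬ W₀.HasSplitMultiplicativeReductionAtPrime 2 ∧ O1.TwoAdicSurjective W₀ ∧
          ∃ q : ℚ, shaAn W₀ = (q : ℂ) ∧ Even (padicValRat 2 q)) →
      ¬ (W₀.HasSplitMultiplicativeReductionAtPrime 2 ∧ O1.TwoAdicSurjective W₀ ∧ W₀.Δ < 0) →
      ¬ (W₀.HasSplitMultiplicativeReductionAtPrime 2 ∧ O1.TwoAdicSurjective W₀ ∧
          ∃ q : ℚ, shaAn W₀ = (q : ℂ) ∧ Even (padicValRat 2 q)) →
      MissingUpperBoundAt W₀ 2) :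
    Summit.BirchSwinnertonDyer.BirchSwinnertonDyer.Theses.ByReductionTypeAtTwo.MultUpperHalfAtTwo := by
  unfold Summit.BirchSwinnertonDyer.BirchSwinnertonDyer.Theses.ByReductionTypeAtTwo.MultUpperHalfAtTwo
  intro W _ _ _ hr hmult
  have hnf : exists_isNewformOf := exists_isNewformOf_of_nonempty_modularParametrizationData hmod
  obtain ⟨W₀, hE₀, hM₀, hN₀, D₀, hiso, -, hopt⟩ :=
    Summit.BirchSwinnertonDyer.Rank1Residual.X12.exists_isIsogenous_optimal hnf W
  have hmult₀ : Mult W₀ 2 :=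
    Summit.BirchSwinnertonDyer.Rank1Residual.X2.IsogenyQuotientLine.hasMultiplicativeReductionAtPrime_of_isIsogenous
      hiso hmult
  have hr₀ : W₀.analyticRank = 0 := (analyticRank_eq_of_isIsogenous' hiso).symm.trans hr
  have hcm₀ : ¬ W₀.HasCM := fun h ↦ Rank1Residual.not_mult_of_hasCM W₀ h 2 hmult₀
  -- the period datum at the optimal curve is PRINT
  have hper₀ : ∀ [NeZero (W₀.conductorNorm ℤ)] (f : CuspForm (Gamma0 (W₀.conductorNorm ℤ)) 2),
      IsNewformOf W₀ f → ∀ ϖ : ℚ, (ϖ : ℝ) * W₀.realPeriodRat = plusPeriod f → 0 ≤ padicValRat 2 ϖ :=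
    fun f hf ϖ hϖ ↦ (padicValRat_periodRatio_eq_zero_of_isOptimalDatum hC W₀ hmult₀ D₀ hopt f hf ϖ hϖ).ge
  refine missingUpperBoundAt_two_of_isogenous_member hmod hGZK hCassels W hr W₀ hiso ?_
  -- road (i): `μ = 0` at `W₀`
  by_cases hμ₀ : ∀ (κ : ZpExtension ℚ 2) (γ : Field.absoluteGaloisGroup ℚ), κ.IsCyclotomic →
      κ.IsTopGenerator γ → IsCyclotomicVariable 2 γ → ∀ D : W₀.SelmerDualData κ γ, D.mu = 0
  · exact missingUpperBoundAt_two_mult_of_mu_eq_zero_of_eulerChar W₀ (hKato W₀ hcm₀ hmult₀) (hECns W₀) h41sp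
      hmod hGZK (hGS W₀) hμ₀ hper₀ hr₀ hmult₀
  -- road (ii): a Prop-5.14 datum at `W₀` (then `μ = 0` is PRINT)
  by_cases h514₀ : ∃ x y : ℚ, W₀.toAffine.Equation x y ∧ 2 * y + W₀.a₁ * x + W₀.a₃ = 0 ∧
      ((TwoTorsionRamifiedAtTwo x ∧ ¬ TwoTorsionOdd W₀ x) ∨
        (TwoTorsionOdd W₀ x ∧ ¬ TwoTorsionRamifiedAtTwo x))
  · obtain ⟨x, y, hP, h2, hΦ⟩ := h514₀
    exact missingUpperBoundAt_two_mult_of_mu_eq_zero_of_eulerChar W₀ (hKato W₀ hcm₀ hmult₀) (hECns W₀) h41sp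
      hmod hGZK (hGS W₀) (fun _ _ hκ hγ _ D ↦ (h514.of_mult W₀ hmult₀ hP h2 hΦ hκ hγ D).2) hper₀ hr₀ hmult₀
  -- road (iii): the sharp non-split door
  by_cases hdoor : ¬ W₀.HasSplitMultiplicativeReductionAtPrime 2 ∧ O1.TwoAdicSurjective W₀ ∧ W₀.Δ < 0
  · exact missingUpperBoundAt_two_nonsplit_of_katoInt_of_eulerChar W₀ (hECns W₀) hmod hGZK (hKint W₀) hper₀ hr₀
      hmult₀ hdoor.1 hdoor.2.1 hdoor.2.2
  -- road (iv): non-split slack one + parity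
  by_cases hpar : ¬ W₀.HasSplitMultiplicativeReductionAtPrime 2 ∧ O1.TwoAdicSurjective W₀ ∧
      ∃ q : ℚ, shaAn W₀ = (q : ℂ) ∧ Even (padicValRat 2 q)
  · exact missingUpperBoundAt_two_nonsplit_of_katoMultUpTo_one_of_even_of_eulerChar W₀ (hECns W₀) hmod hGZK
      hCT hC (fun f L ↦ hK1 W₀ f L) hr₀ hmult₀ hpar.1 hpar.2.1 hpar.2.2
  -- road (v): the sharp split door
  by_cases hdoorSp : W₀.HasSplitMultiplicativeReductionAtPrime 2 ∧ O1.TwoAdicSurjective W₀ ∧ W₀.Δ < 0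
  · exact O1.missingUpperBoundAt_two_split_of_katoInt W₀ h41sp (hGS W₀ hdoorSp.1) hmod hGZK (hKintSp W₀) hr₀ hmult₀
      hdoorSp.1 hdoorSp.2.1 hdoorSp.2.2
  -- road (vi): split slack one + parity
  by_cases hparSp : W₀.HasSplitMultiplicativeReductionAtPrime 2 ∧ O1.TwoAdicSurjective W₀ ∧
      ∃ q : ℚ, shaAn W₀ = (q : ℂ) ∧ Even (padicValRat 2 q)
  · exact missingUpperBoundAt_two_split_of_katoUpToOne_of_even W₀ h41sp (hGS W₀ hparSp.1) hmod hGZK hCT hC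
      (hK1sp W₀ hmult₀ hparSp.1 hparSp.2.1) hr₀ hmult₀ hparSp.1 hparSp.2.1 hparSp.2.2
  -- off the six roads
  exact hoff W₀ hcm₀ hr₀ hmult₀ D₀ hopt hμ₀ h514₀ hdoor hpar hdoorSp hparSp

/-- **The six-road reduction on the GUARDED twin of Greenberg's non-split display** (`h41ns' :
thm41Analogue_charValue_rankZero_numberField_anyPrime_oddLocalDegree`, p425330; glue
`O1.twoAdicEulerCharRankZeroNonsplitMult_zero_of_greenberg'`, p428013) — the audit-clean instance (N-1) for the
planner's split / the line `four_roads` reshaped to six roads: PRINT ×8 + MEMO ×6 + residual ⟹ `MultUpperHalfAtTwo`.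
[cite: GreenbergLNM1716, §3 Note (p. 93) and §4 pp. 112–113] [cite: Miller2011LMS, Def. 1.1] -/
theorem multUpperHalfAtTwo_of_sixRoads'
    (hKato : ∀ (W : WeierstrassCurve ℚ) [W.IsElliptic] [W.IsGloballyMinimal],
      ¬ W.HasCM → Mult W 2 → O1.KatoMultiplicativeDivisibilityRat W 2)
    (h41ns' : thm41Analogue_charValue_rankZero_numberField_anyPrime_oddLocalDegree)
    (h41sp : thm41Analogue_charValue_rankZero_split_baseChange_anyPrime)
    (hmod : nonempty_modularParametrizationData)
    (hGZK : rank_eq_analyticRank_of_analyticRank_le_one)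
    (hCassels : bsdRHS_eq_of_isIsogenous)
    (h514 : prop514_isTorsion_mu_eq_zero_two)
    (hC : cesnavicius_not_two_dvd_maninConstant_of_two_dvd_level)
    (hCT : WeierstrassCurve.exists_casselsTate_pairing (K := ℚ))
    (hGS : ∀ (W : WeierstrassCurve ℚ) [W.IsElliptic] [W.IsGloballyMinimal],
      W.HasSplitMultiplicativeReductionAtPrime 2 → greenberg_stevens (W := W) (p := 2))
    (hKint : ∀ (W : WeierstrassCurve ℚ) [W.IsElliptic] [W.IsGloballyMinimal],
      O1.KatoDivisibilityAtTwoNonsplitMultInt W)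
    (hK1 : ∀ (W : WeierstrassCurve ℚ) [W.IsElliptic] [W.IsGloballyMinimal] {N : ℕ} [NeZero N]
      (f : CuspForm (Gamma0 N) 2) (L : PowerSeries ℚ_[2]), O1.KatoDivisibilityAtTwoMultUpTo W 1 f (-1) L)
    (hKintSp : ∀ (W : WeierstrassCurve ℚ) [W.IsElliptic] [W.IsGloballyMinimal],
      O1.KatoDivisibilityAtTwoSplitMultInt W)
    (hK1sp : ∀ (W : WeierstrassCurve ℚ) [W.IsElliptic] [W.IsGloballyMinimal],
      Mult W 2 → W.HasSplitMultiplicativeReductionAtPrime 2 → O1.TwoAdicSurjective W →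
      ∀ (κ : ZpExtension ℚ 2) (γ : Field.absoluteGaloisGroup ℚ), κ.IsCyclotomic → κ.IsTopGenerator γ →
      IsCyclotomicVariable 2 γ →
      ∀ [NeZero (W.conductorNorm ℤ)] (f : CuspForm (Gamma0 (W.conductorNorm ℤ)) 2), IsNewformOf W f →
      ∀ ϖ : ℚ, (ϖ : ℝ) * W.realPeriodRat = plusPeriod f →
      ∀ L : PowerSeries ℚ_[2], IsSplitMultPAdicLFunctionOf f 2 L → ∀ D : W.SelmerDualData κ γ,
        D.IsTorsion ∧ ∃ g ∈ D.charIdeal,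
          iwasawaToPowerSeries 2 (PowerSeries.X * g) = PowerSeries.C ((2 * ϖ : ℚ) : ℚ_[2]) * L)
    (hoff : ∀ (W₀ : WeierstrassCurve ℚ) [W₀.IsElliptic] [W₀.IsGloballyMinimal]
      [NeZero (W₀.conductorNorm ℤ)], ¬ W₀.HasCM → W₀.analyticRank = 0 → Mult W₀ 2 →
      ∀ D₀ : ModularParametrizationData W₀ (W₀.conductorNorm ℤ), Zhai2021.IsOptimalDatum W₀ D₀ →
      (¬ ∀ (κ : ZpExtension ℚ 2) (γ : Field.absoluteGaloisGroup ℚ), κ.IsCyclotomic →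
          κ.IsTopGenerator γ → IsCyclotomicVariable 2 γ → ∀ D : W₀.SelmerDualData κ γ, D.mu = 0) →
      (¬ ∃ x y : ℚ, W₀.toAffine.Equation x y ∧ 2 * y + W₀.a₁ * x + W₀.a₃ = 0 ∧
          ((TwoTorsionRamifiedAtTwo x ∧ ¬ TwoTorsionOdd W₀ x) ∨
            (TwoTorsionOdd W₀ x ∧ ¬ TwoTorsionRamifiedAtTwo x))) →
      ¬ (¬ W₀.HasSplitMultiplicativeReductionAtPrime 2 ∧ O1.TwoAdicSurjective W₀ ∧ W₀.Δ < 0) →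
      ¬ (¬ W₀.HasSplitMultiplicativeReductionAtPrime 2 ∧ O1.TwoAdicSurjective W₀ ∧
          ∃ q : ℚ, shaAn W₀ = (q : ℂ) ∧ Even (padicValRat 2 q)) →
      ¬ (W₀.HasSplitMultiplicativeReductionAtPrime 2 ∧ O1.TwoAdicSurjective W₀ ∧ W₀.Δ < 0) →
      ¬ (W₀.HasSplitMultiplicativeReductionAtPrime 2 ∧ O1.TwoAdicSurjective W₀ ∧
          ∃ q : ℚ, shaAn W₀ = (q : ℂ) ∧ Even (padicValRat 2 q)) →
      MissingUpperBoundAt W₀ 2) :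
    Summit.BirchSwinnertonDyer.BirchSwinnertonDyer.Theses.ByReductionTypeAtTwo.MultUpperHalfAtTwo :=
  multUpperHalfAtTwo_of_sixRoads_of_eulerChar hKato
    (fun W _ _ ↦ O1.twoAdicEulerCharRankZeroNonsplitMult_zero_of_greenberg' W h41ns') h41sp hmod hGZK hCassels
    h514 hC hCT hGS hKint hK1 hKintSp hK1sp hoff

end Summit.BirchSwinnertonDyer.BirchSwinnertonDyer.Theorems

end
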